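import Summits.AtomisticToContinuum.BoseEinsteinCondensation.Theses.BECStronglyRayleigh
import Literature.MathematicalPhysics.QuantumLattice.LiebMattisSectorPF
import Literature.MathematicalPhysics.QuantumLattice.GinibreDoublingProofs
import Literature.MathematicalPhysics.QuantumLattice.HubbardGapBounds
import HarnessLib

/-!
# Structure of the Gibbs weight of the hard-core boson Hamiltonian: stub `stub_gibbsStructure` of
# line `stable-cone-variational-selection` for crux `GroundStateStability` (stmt-AtomisticToContinuum-9672)

Stub E1 of the skeleton `Cruxes/GroundStateStability/Lines/stable-cone-variational-selection.lean`:
for the spin-`½` Hamiltonian `H = xxzHamiltonian 1 G (-1) Δ + Σ_x μ_x S³_x` (arbitrary real `Δ`,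
`μ`) and `τ > 0`, the Gibbs weight `T = e^{-τH}` is

* positive semidefinite (`Matrix.posDef_gibbsWeight`, `H` Hermitian);
* entrywise a nonnegative real matrix, hence maps entrywise nonnegative real vectors to entrywise
  nonnegative real vectors: in the product basis `H = -H_Heis(J = 1) + D` with `D` a real diagonal
  matrix (`gibbsStr_decomp`), so `-τH` has real entries, nonnegative off the diagonal
  (`LiebMattis.heisenbergHamiltonian_apply_eq_real`), and `e^{A} = e^{-κ} e^{A + κ}`
  (`exp_add_smul_one`) with `A + κ` entrywise nonnegative (`entrywise_nonneg_exp`);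
* sector preserving: `H` commutes with `S³_tot` (`commute_heisenbergHamiltonian_totalSpin` and
  diagonal times diagonal), hence so does `e^{-τH}` (`Commute.exp_left`), and an operator commuting
  with `S³_tot` preserves its eigenspaces.

All statements are finite-dimensional matrix algebra. [folklore]
-/

noncomputable section

namespace Summit.AtomisticToContinuum.BoseEinsteinCondensation.Cruxes.GroundStateStability.StableConeVariationalSelection

open scoped BigOperators Matrix ComplexOrder
open Literature.MathematicalPhysics.QuantumLattice
open Matrix Complex

/-! ### Generic matrix facts -/

section General

variable {ι : Type*} [Fintype ι] [DecidableEq ι]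

/-- **Stoquastic exponentials are entrywise nonnegative.** If a complex matrix `A` has real
entries that are nonnegative off the diagonal, then every entry of `e^{A}` is a nonnegative real:
shift by `κ = Σ_i |A_ii|` to make all entries nonnegative, use `entrywise_nonneg_exp`, and undo the
shift with `e^{A} = e^{-κ} e^{A + κ·1}` (`exp_add_smul_one`). [folklore] -/
theorem gibbsStr_exp_entry_nonneg (A : Matrix ι ι ℂ) (hre : ∀ i j, (A i j).im = 0)
    (hoff : ∀ i j, i ≠ j → 0 ≤ (A i j).re) : ∀ i j, 0 ≤ NormedSpace.exp A i j := by
  have hκ : ∀ i, -(A i i).re ≤ ∑ j, |(A j j).re| := fun i => by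
    have h1 : -(A i i).re ≤ |(A i i).re| := neg_le_abs _
    have h2 : |(A i i).re| ≤ ∑ j, |(A j j).re| :=
      Finset.single_le_sum (f := fun j => |(A j j).re|) (fun j _ => abs_nonneg _)
        (Finset.mem_univ i)
    linarith
  have hB : ∀ i j, 0 ≤ (A + ((∑ j, |(A j j).re| : ℝ) : ℂ) • (1 : Matrix ι ι ℂ)) i j := by
    intro i j
    rw [Matrix.add_apply, Matrix.smul_apply, smul_eq_mul, Complex.nonneg_iff]
    by_cases hij : i = j
    · subst hij
      rw [Matrix.one_apply_eq, mul_one, Complex.add_re, Complex.add_im, Complex.ofReal_re,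
        Complex.ofReal_im, hre, add_zero]
      exact ⟨by linarith [hκ i], rfl⟩
    · rw [Matrix.one_apply_ne hij, mul_zero, add_zero]
      exact ⟨hoff i j hij, (hre i j).symm⟩
  have hexp : NormedSpace.exp A = Complex.exp (-((∑ j, |(A j j).re| : ℝ) : ℂ)) •
      NormedSpace.exp (A + ((∑ j, |(A j j).re| : ℝ) : ℂ) • (1 : Matrix ι ι ℂ)) := by
    rw [← exp_add_smul_one, add_assoc, ← add_smul, add_neg_cancel, zero_smul, add_zero]
  intro i j
  rw [hexp, Matrix.smul_apply, smul_eq_mul, ← Complex.ofReal_neg, ← Complex.ofReal_exp]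
  exact mul_nonneg (Complex.zero_le_real.mpr (Real.exp_pos _).le) (entrywise_nonneg_exp hB i j)

omit [DecidableEq ι] in
/-- An entrywise nonnegative matrix maps entrywise nonnegative vectors to entrywise nonnegative
vectors. [folklore] -/
theorem gibbsStr_mulVec_nonneg {T : Matrix ι ι ℂ} (hT : ∀ i j, 0 ≤ T i j) {φ : ι → ℂ}
    (hφ : ∀ j, 0 ≤ φ j) (i : ι) : 0 ≤ (T *ᵥ φ) i := by
  rw [mulVec, dotProduct]
  exact Finset.sum_nonneg fun j _ => mul_nonneg (hT i j) (hφ j)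

omit [Fintype ι] in
/-- A finite sum of diagonal matrices is the diagonal matrix of the sum. [folklore] -/
theorem gibbsStr_sum_diagonal {κ : Type*} (s : Finset κ) (f : κ → ι → ℂ) :
    ∑ k ∈ s, diagonal (f k) = diagonal fun i => ∑ k ∈ s, f k i := by
  ext i j
  rw [Matrix.sum_apply]
  by_cases h : i = j
  · subst h
    rw [diagonal_apply_eq]
    exact Finset.sum_congr rfl fun k _ => diagonal_apply_eq _ _
  · rw [diagonal_apply_ne _ h]
    exact Finset.sum_eq_zero fun k _ => diagonal_apply_ne _ h

end General

/-! ### The Hamiltonian in the product basis: `H = -H_Heis(J = 1) + (real diagonal)` -/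

section Lattice

variable {Λ : Type*} [Fintype Λ] [DecidableEq Λ]

/-- `S³_x` is diagonal in the product basis with real entries `½ - σ_x`. [folklore] -/
theorem gibbsStr_siteSpin_two (x : Λ) :
    (siteSpin 1 x 2 : Op Λ 2) =
      diagonal fun σ : TensorIndex Λ 2 => ((1 / 2 - ((σ x : ℕ) : ℝ) : ℝ) : ℂ) := by
  rw [siteSpin, spinVec_two, SpinOperators.spinZ, LiebMattis.onSite_diagonal]
  congr 1
  funext σ
  push_cast
  ring

/-- The Ising bond `½(S³_x S³_y + S³_y S³_x)` is diagonal with real entries `(½ - σ_x)(½ - σ_y)`.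
[folklore] -/
theorem gibbsStr_spinBond_two (x y : Λ) :
    (spinBond 1 2 x y : Op Λ 2) =
      diagonal fun σ : TensorIndex Λ 2 =>
        (((1 / 2 - ((σ x : ℕ) : ℝ)) * (1 / 2 - ((σ y : ℕ) : ℝ)) : ℝ) : ℂ) := by
  rw [spinBond, gibbsStr_siteSpin_two, gibbsStr_siteSpin_two, diagonal_mul_diagonal,
    diagonal_mul_diagonal, diagonal_add]
  ext σ τ
  rw [Matrix.smul_apply, diagonal_apply, diagonal_apply]
  split_ifs with h
  · rw [smul_eq_mul]
    push_cast
    ring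
  · rw [smul_zero]

/-- **The XXZ Hamiltonian at `J = -1` versus the antiferromagnet**:
`xxzHamiltonian 1 G (-1) Δ = -H_Heis(J = 1) + (1 - Δ) · diag(Σ_{xy ∈ E} (½ - σ_x)(½ - σ_y))`.
[folklore] -/
theorem gibbsStr_xxz_eq (G : SimpleGraph Λ) [DecidableRel G.Adj] (Δ : ℝ) :
    (xxzHamiltonian 1 G (-1) Δ : Op Λ 2) = -heisenbergHamiltonian 1 G 1 +
      ((1 - Δ : ℝ) : ℂ) • diagonal fun σ : TensorIndex Λ 2 =>
        ((∑ e ∈ G.edgeFinset,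
          Sym2.lift ⟨fun x y => (1 / 2 - ((σ x : ℕ) : ℝ)) * (1 / 2 - ((σ y : ℕ) : ℝ)),
            fun _ _ => mul_comm _ _⟩ e : ℝ) : ℂ) := by
  have hterm : ∀ e : Sym2 Λ,
      (Sym2.lift ⟨fun x y => spinBond 1 0 x y + spinBond 1 1 x y + (Δ : ℂ) • spinBond 1 2 x y,
          fun x y => by simp only [spinBond_comm]⟩ e : Op Λ 2) =
        spinDotSym 1 e - ((1 - Δ : ℝ) : ℂ) • diagonal fun σ : TensorIndex Λ 2 =>
          ((Sym2.lift ⟨fun x y => (1 / 2 - ((σ x : ℕ) : ℝ)) * (1 / 2 - ((σ y : ℕ) : ℝ)),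
            fun _ _ => mul_comm _ _⟩ e : ℝ) : ℂ) := by
    intro e
    induction e using Sym2.ind with
    | h x y =>
      simp only [Sym2.lift_mk, spinDotSym_mk, spinDot, Fin.sum_univ_three]
      rw [gibbsStr_spinBond_two, Complex.ofReal_sub, Complex.ofReal_one, sub_smul, one_smul]
      abel
  have hdiag : (∑ e ∈ G.edgeFinset, diagonal fun σ : TensorIndex Λ 2 =>
      ((Sym2.lift ⟨fun x y => (1 / 2 - ((σ x : ℕ) : ℝ)) * (1 / 2 - ((σ y : ℕ) : ℝ)),
        fun _ _ => mul_comm _ _⟩ e : ℝ) : ℂ)) =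
      diagonal fun σ : TensorIndex Λ 2 =>
        ((∑ e ∈ G.edgeFinset,
          Sym2.lift ⟨fun x y => (1 / 2 - ((σ x : ℕ) : ℝ)) * (1 / 2 - ((σ y : ℕ) : ℝ)),
            fun _ _ => mul_comm _ _⟩ e : ℝ) : ℂ) := by
    rw [gibbsStr_sum_diagonal]
    congr 1
    funext σ
    rw [Complex.ofReal_sum]
  unfold xxzHamiltonian heisenbergHamiltonian
  rw [Finset.sum_congr rfl fun e _ => hterm e, Finset.sum_sub_distrib, ← Finset.smul_sum, hdiag,
    Complex.ofReal_neg, Complex.ofReal_one, neg_one_smul, one_smul, neg_sub, sub_eq_neg_add]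

/-- The field term `Σ_x μ_x S³_x` is diagonal with real entries `Σ_x μ_x (½ - σ_x)`. [folklore] -/
theorem gibbsStr_field_eq (μ : Λ → ℝ) :
    (∑ x : Λ, ((μ x : ℝ) : ℂ) • siteSpin 1 x 2 : Op Λ 2) =
      diagonal fun σ : TensorIndex Λ 2 => ((∑ x, μ x * (1 / 2 - ((σ x : ℕ) : ℝ)) : ℝ) : ℂ) := by
  have h : ∀ x : Λ, (((μ x : ℝ) : ℂ) • siteSpin 1 x 2 : Op Λ 2) =
      diagonal fun σ : TensorIndex Λ 2 => ((μ x * (1 / 2 - ((σ x : ℕ) : ℝ)) : ℝ) : ℂ) := by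
    intro x
    rw [gibbsStr_siteSpin_two, ← diagonal_smul]
    congr 1
    funext σ
    rw [Pi.smul_apply, smul_eq_mul, Complex.ofReal_mul]
  rw [Finset.sum_congr rfl fun x _ => h x, gibbsStr_sum_diagonal]
  congr 1
  funext σ
  rw [Complex.ofReal_sum]

/-- **`H = -H_Heis(J = 1) + D` with `D` a real diagonal matrix** for
`H = xxzHamiltonian 1 G (-1) Δ + Σ_x μ_x S³_x`. [folklore] -/
theorem gibbsStr_decomp (G : SimpleGraph Λ) [DecidableRel G.Adj] (Δ : ℝ) (μ : Λ → ℝ) :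
    ∃ d : TensorIndex Λ 2 → ℝ,
      (xxzHamiltonian 1 G (-1) Δ + ∑ x : Λ, ((μ x : ℝ) : ℂ) • siteSpin 1 x 2 : Op Λ 2) =
        -heisenbergHamiltonian 1 G 1 + diagonal fun σ => ((d σ : ℝ) : ℂ) := by
  refine ⟨fun σ => (1 - Δ) * (∑ e ∈ G.edgeFinset,
      Sym2.lift ⟨fun x y => (1 / 2 - ((σ x : ℕ) : ℝ)) * (1 / 2 - ((σ y : ℕ) : ℝ)),
        fun _ _ => mul_comm _ _⟩ e) + ∑ x, μ x * (1 / 2 - ((σ x : ℕ) : ℝ)), ?_⟩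
  rw [gibbsStr_xxz_eq, gibbsStr_field_eq, add_assoc, ← diagonal_smul, diagonal_add]
  congr 2
  funext σ
  rw [Pi.smul_apply, smul_eq_mul, Complex.ofReal_add, Complex.ofReal_mul]

/-- **Entries and symmetry of `H`.** In the product basis `H = xxzHamiltonian 1 G (-1) Δ + Σ μ_x S³_x`
has real entries, nonpositive off the diagonal (hopping amplitude `-½` per edge: `H` is
stoquastic), commutes with `S³_tot`, and is Hermitian. [folklore] -/
theorem gibbsStr_entries (G : SimpleGraph Λ) [DecidableRel G.Adj] (Δ : ℝ) (μ : Λ → ℝ) :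
    (∀ σ τ : TensorIndex Λ 2,
        ((xxzHamiltonian 1 G (-1) Δ + ∑ x : Λ, ((μ x : ℝ) : ℂ) • siteSpin 1 x 2) σ τ).im = 0) ∧
    (∀ σ τ : TensorIndex Λ 2, σ ≠ τ →
        ((xxzHamiltonian 1 G (-1) Δ + ∑ x : Λ, ((μ x : ℝ) : ℂ) • siteSpin 1 x 2) σ τ).re ≤ 0) ∧
    Commute (xxzHamiltonian 1 G (-1) Δ + ∑ x : Λ, ((μ x : ℝ) : ℂ) • siteSpin 1 x 2)
      (totalSpin 1 2) ∧
    (xxzHamiltonian 1 G (-1) Δ + ∑ x : Λ, ((μ x : ℝ) : ℂ) • siteSpin 1 x 2).IsHermitian := by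
  obtain ⟨d, hd⟩ := gibbsStr_decomp G Δ μ
  rw [hd]
  have him : ∀ σ τ : TensorIndex Λ 2, (heisenbergHamiltonian 1 G 1 σ τ).im = 0 := fun σ τ => by
    have h := LiebMattis.star_heisenbergHamiltonian_apply 1 G 1 σ τ
    rw [Complex.star_def] at h
    exact Complex.conj_eq_iff_im.mp h
  refine ⟨fun σ τ => ?_, fun σ τ hστ => ?_, ?_, ?_⟩
  · rw [Matrix.add_apply, Matrix.neg_apply, Complex.add_im, Complex.neg_im, him, neg_zero, zero_add,
      diagonal_apply]
    split_ifs
    · exact Complex.ofReal_im _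
    · exact Complex.zero_im
  · rw [Matrix.add_apply, Matrix.neg_apply, diagonal_apply_ne _ hστ, add_zero, Complex.neg_re,
      neg_nonpos]
    obtain ⟨t, ht0, ht⟩ := LiebMattis.heisenbergHamiltonian_apply_eq_real 1 G 1 zero_le_one hστ
    rw [ht, Complex.ofReal_re]
    exact ht0
  · refine Commute.add_left (commute_heisenbergHamiltonian_totalSpin 1 G 1 2).neg_left ?_
    rw [LiebMattis.totalSpin_two_eq_diagonal]
    change diagonal _ * diagonal _ = diagonal _ * diagonal _
    rw [diagonal_mul_diagonal, diagonal_mul_diagonal]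
    exact congrArg diagonal (funext fun σ => mul_comm _ _)
  · refine (heisenbergHamiltonian_isHermitian 1 G 1).neg.add ?_
    exact Matrix.isHermitian_diagonal_iff.mpr fun σ => by
      rw [isSelfAdjoint_iff, Complex.star_def, Complex.conj_ofReal]

/-- An operator commuting with `S³_tot` preserves every magnetisation sector. [folklore] -/
theorem gibbsStr_sector_of_commute {T : Op Λ 2} (hc : Commute T (totalSpin 1 2)) (M : ℝ)
    (φ : TensorIndex Λ 2 → ℂ) (hφ : φ ∈ spinZSector 1 M) : T *ᵥ φ ∈ spinZSector 1 M := by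
  rw [spinZSector, Module.End.mem_eigenspace_iff, Matrix.toLin'_apply] at hφ ⊢
  exact LiebMattis.mulVec_eigenvector_of_commute 1 hc.symm hφ

end Lattice

/-! ### The stub -/

/-- **Stub E1 — structure of the Gibbs weight.** For `H = xxzHamiltonian 1 G (-1) Δ + Σ_x μ_x S³_x`
(hard-core bosons with hopping `-½` per edge; arbitrary real `Δ`, `μ`) and `τ > 0`, the Gibbs weight
`T = e^{-τH}` is positive semidefinite, maps entrywise nonnegative real vectors to entrywise
nonnegative real vectors (it is entrywise a nonnegative real matrix, `H` being stoquastic), and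
preserves every magnetisation sector (`[H, S³_tot] = 0`). [folklore] -/
theorem stub_gibbsStructure :
    ∀ (Λ : Type) [Fintype Λ] [DecidableEq Λ] (G : SimpleGraph Λ) [DecidableRel G.Adj] (Δ : ℝ) (μ : Λ → ℝ)
      (τ : ℝ), 0 < τ →
      (Matrix.gibbsWeight τ (xxzHamiltonian 1 G (-1) Δ + ∑ x : Λ, ((μ x : ℝ) : ℂ) • siteSpin 1 x 2)).PosSemidef ∧
      (∀ φ : TensorIndex Λ 2 → ℂ,
        (∀ σ : TensorIndex Λ 2, 0 ≤ (φ σ).re ∧ (φ σ).im = 0) →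
        (∀ σ : TensorIndex Λ 2, 0 ≤ ((Matrix.gibbsWeight τ (xxzHamiltonian 1 G (-1) Δ + ∑ x : Λ, ((μ x : ℝ) : ℂ) • siteSpin 1 x 2) *ᵥ φ) σ).re ∧ ((Matrix.gibbsWeight τ (xxzHamiltonian 1 G (-1) Δ + ∑ x : Λ, ((μ x : ℝ) : ℂ) • siteSpin 1 x 2) *ᵥ φ) σ).im = 0)) ∧
      (∀ (M : ℝ) (φ : TensorIndex Λ 2 → ℂ), φ ∈ spinZSector 1 M →
        Matrix.gibbsWeight τ (xxzHamiltonian 1 G (-1) Δ + ∑ x : Λ, ((μ x : ℝ) : ℂ) • siteSpin 1 x 2) *ᵥ φ ∈ spinZSector 1 M) := by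
  intro Λ _ _ G _ Δ μ τ hτ
  obtain ⟨him, hoff, hcomm, hH⟩ := gibbsStr_entries G Δ μ
  have hT : ∀ i j, 0 ≤ Matrix.gibbsWeight τ
      (xxzHamiltonian 1 G (-1) Δ + ∑ x : Λ, ((μ x : ℝ) : ℂ) • siteSpin 1 x 2) i j := by
    rw [Matrix.gibbsWeight]
    refine gibbsStr_exp_entry_nonneg _ (fun i j => ?_) (fun i j hij => ?_)
    · rw [Matrix.smul_apply, smul_eq_mul, Complex.mul_im, Complex.neg_re, Complex.neg_im,
        Complex.ofReal_re, Complex.ofReal_im, him, neg_zero, mul_zero, zero_mul, add_zero]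
    · have h1 := hoff i j hij
      rw [Matrix.smul_apply, smul_eq_mul, Complex.mul_re, Complex.neg_re, Complex.neg_im,
        Complex.ofReal_re, Complex.ofReal_im, him, neg_zero, mul_zero, sub_zero]
      nlinarith
  refine ⟨(Matrix.posDef_gibbsWeight τ hH).posSemidef, fun φ hφ σ => ?_, fun M φ hφ => ?_⟩
  · have h := gibbsStr_mulVec_nonneg hT
      (fun j => Complex.nonneg_iff.mpr ⟨(hφ j).1, (hφ j).2.symm⟩) σ
    rw [Complex.nonneg_iff] at h
    exact ⟨h.1, h.2.symm⟩
  · refine gibbsStr_sector_of_commute ?_ M φ hφ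
    rw [Matrix.gibbsWeight]
    exact (hcomm.smul_left (-(τ : ℂ))).exp_left

end Summit.AtomisticToContinuum.BoseEinsteinCondensation.Cruxes.GroundStateStability.StableConeVariationalSelection
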